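/-
Origin: expansion seat `prover-pub-hodgecm-own-htheta-g2-0`, handover #H19 2026-08-21T12:56:38Z md5 0544233ce5c1 (108 l.; NEW additive MODEL leaf — the junction head at a face in the UN-INFLATED `Uiso` form that stage 2's `FaceSupply` displays; author htheta-x1 under own-htheta; imports #H18 + `HodgeCM.Model.CMInflationRiemann` + `HodgeCM.PerL34.ThetaSubOfLiu`; ns HodgeCM.Model.SInstance; 1 theorem `exists_faceCtx_theta_subset_Uiso` (:79): for an END-STATE theta model `R := C.thetaModel (orientBitι F ι₁) d12 d34` over `picardCMUniverse hHD hI h₁ h₃`, F Galois CM, 6 ≤ [F:ℚ], face f, `f.Admissible ι₁`, `(mk ι₁).embedding = ι₁`, `V : HermSpace3 F ι₁`: ∃ D, (R.GoodCtx ι₁ c ∧ GOG V c) ∧ ∀ i, ∃ Γ₀, ∀ Γ ≤ Γ₀, R.Theta V c i Γ ⊆ U.Uiso Γ F (f.psi i) ι₁ at c := faceCtx F f ι₁ D — from #H18 §4 by `Universe.Uiso_inflate_le` (`PerL34/ThetaSubOfLiu.lean`:291) over `modelAxiomsPerL….pull_comp`, `fact_alphaLine`, `fact_cmInflation_riemann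 … hR`; hypotheses = `h418` (pinned-dictionary [Liu21 Thm 4.18 r8] at V over F), `hR`, `hRΘ`, `hA`, the pin section — nothing else; 0 `def … : Prop`, nothing cited. CERT rc 0, 1 ∕ 1 trio as in the header; ROWDEP #H18; NAMES for audit: HodgeCM.Model.SInstance.exists_faceCtx_theta_subset_Uiso) (`HOME/pub-hodgecm-own-htheta/stage76/HodgeCM/Model/HThetaJunctionFaceUiso.lean`, md5 0544233ce5c1, 108 lines);
landed by the p-seat packager p gen 32 (p-g32) in gate run 76 as `HodgeCM/Model/HThetaJunctionFaceUiso.lean` (verbatim).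
-/
/-
Copyright (c) 2026 the pub-hodgecm formalisation cell (harness21).  New file, not vendored.  DRAFT (x1 work file, NOT a PKG path).
Origin: seat `prover-pub-hodgecm-htheta-x1-0` (unit pub-hodgecm-htheta-x1, EOD SURGE (1a) extra prover x1 UNDER own-htheta), 2026-08-21 —
ADDITIVE SEQUEL to own-htheta #H18 `Model/HThetaJunctionFace.lean` (x1 FACE v1 6b5cdcf521ea, kitted byte-identical for RUN 75, own-htheta STATUS 12:50:48Z;
that file is byte-frozen, so the un-inflated form lives HERE).  Imports #H18 + the installed PKG modules `Model/CMInflationRiemann` (M38 on the model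
universe from Riemann ∕ `hR`) and `PerL34/ThetaSubOfLiu` (`Universe.Uiso_inflate_le`).  KERNEL ONLY: 1 theorem, no proof holes, nothing cited, no hypothesis
kind of E; nothing here is a claim of the manuscripts under adjudication.

WHAT IT IS — `SInstance.exists_faceCtx_theta_subset_Uiso`: #H18 §4 `SInstance.exists_faceCtx_hsmall_of_thm418C` UN-INFLATED.  For an END-STATE theta
model `R := C.thetaModel (orientBitι F ι₁) d12 d34` over `U := picardCMUniverse hHD hI h₁ h₃`, `F` Galois CM with `6 ≤ [F:ℚ]`, a face `f`, `f.Admissible ι₁`,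
`(mk ι₁).embedding = ι₁`, `V : HermSpace3 F ι₁`:  `∃ D, (R.GoodCtx ι₁ c ∧ GOG V c) ∧ ∀ i, ∃ Γ₀, ∀ Γ ≤ Γ₀, R.Theta V c i Γ ⊆ U.Uiso Γ F (f.psi i) ι₁`
at `c := faceCtx F f ι₁ D` — membership in the SAME `U.Uiso Γ F (f.psi i) ι₁` that `FaceSupply` displays (tree `CorCM/B01/FaceInputsSplit.lean`:50),
by `Universe.Uiso_inflate_le` (`U_{(M, Φ^M, σ')}(Γ) ≤ U_{(K, Φ, σ' ∘ k)}(Γ)`, `PerL34/ThetaSubOfLiu.lean`:291) over the model rows `Fact_pull_comp`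
(`Model.modelAxiomsPerL`), `Fact_alphaLine` (`Model.fact_alphaLine`), `Fact_cmInflation` (`Model.fact_cmInflation_riemann`, from `hR`) and `σ' ∘ k = ι₁`.
Hypotheses = `h418` ([Liu21 Thm 4.18 r8] over the pinned dictionary at `V`), `hR`, `hRΘ` (∀ c), `hA`, the pin section — nothing else.  NOT supplied
(theta side): non-vanishing of a theta class at a face.
-/
import Summits.HodgeConjecture.HodgeCM.Model.HThetaJunctionFace
import Summits.HodgeConjecture.HodgeCM.Model.CMInflationRiemann
import Summits.HodgeConjecture.HodgeCM.PerL34.ThetaSubOfLiu_2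

set_option autoImplicit false

noncomputable section

open NumberField NumberField.InfinitePlace
open scoped Matrix Classical TensorProduct
open Literature.AlgebraicGeometry.HodgeTheory Literature.NumberTheory.Automorphic.PicardCM
open Literature.NumberTheory.Transcendental (Arapura2012_Cor_15_4_6)
open Literature.NumberTheory.Automorphic Literature.NumberTheory.Automorphic.UnitaryGroup
open Literature.NumberTheory.GelbartRogawski1991 Literature.NumberTheory.GelbartRogawski1991.UnitaryDualPair
open HodgeCM.Model.HypCensus HodgeCM.Model.SupplyInstance HodgeCM.Model.ArchSideTerm
open HodgeCM.Model.ThetaSpace HodgeCM.Model.TowerLevel HodgeCM.Model.TowerCarrier HodgeCM.Literature.Theta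

namespace HodgeCM.Model.SInstance

open HodgeCM.Model.ThetaAdelicSide HodgeCM.Model.LiuIndex

variable (hHD : exists_isReal_hodgeModel) (hI : hodgePQ_independent_of_hodgeModel)
  (h₁ : BallQuotientUniformised) (h₃ : CMAbelianVarietyRealised) (hA : Arapura2012_Cor_15_4_6)

variable
  (hGR : ∀ {L : CMField} {ι₁ : L →+* ℂ} (V : HermSpace3 L ι₁) (c : SeesawCtx L),
    (cmSplittingDatum (L : Type) finProdFinEquiv (frameD V) (frameD_real V) (frameD_ne V) (dW c.D) (dW_real c.D)
      (dW_ne c.D)).CompatibleSplitting)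
  (hGR₀ : ∀ {L : CMField} {ι₁ : L →+* ℂ} (V : HermSpace3 L ι₁) (c : SeesawCtx L),
    (cmSplittingDatum (L : Type) (e₁) (frameD V) (frameD_real V) (frameD_ne V) (lineVec (L : Type) (dW c.D 0))
      (fun _ => dW_real c.D 0) (fun _ => dW_ne c.D 0)).CompatibleSplitting)
  (hGR₁ : ∀ {L : CMField} {ι₁ : L →+* ℂ} (V : HermSpace3 L ι₁) (c : SeesawCtx L),
    (cmSplittingDatum (L : Type) (e₁) (frameD V) (frameD_real V) (frameD_ne V) (lineVec (L : Type) (dW c.D 1))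
      (fun _ => dW_real c.D 1) (fun _ => dW_ne c.D 1)).CompatibleSplitting)
  (hGR₂ : ∀ {L : CMField} {ι₁ : L →+* ℂ} (V : HermSpace3 L ι₁) (c : SeesawCtx L),
    (cmSplittingDatum (L : Type) (e₁) (frameD V) (frameD_real V) (frameD_ne V) (lineVec (L : Type) (dW' c.D 0))
      (fun _ => dW'_real c.D 0) (fun _ => dW'_ne c.D 0)).CompatibleSplitting)
  (hGR₃ : ∀ {L : CMField} {ι₁ : L →+* ℂ} (V : HermSpace3 L ι₁) (c : SeesawCtx L),
    (cmSplittingDatum (L : Type) (e₁) (frameD V) (frameD_real V) (frameD_ne V) (lineVec (L : Type) (dW' c.D 1))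
      (fun _ => dW'_real c.D 1) (fun _ => dW'_ne c.D 1)).CompatibleSplitting)
  (μ : ∀ {L : CMField}, SeesawCtx L → Fin 4 → NumberField.InfinitePlace (L : Type) → ℤ)
  (hΔ₁ : ∀ {L : CMField} {ι₁ : L →+* ℂ} (V : HermSpace3 L ι₁) (c : SeesawCtx L), ∀ hc : GOG V c,
    slotTypeVec V c (hGR V c) (hGR₀ V c) (hGR₁ V c) (hGR₂ V c) (hGR₃ V c) (hG_GOG V c hc) 1 -
      slotTypeVec V c (hGR V c) (hGR₀ V c) (hGR₁ V c) (hGR₂ V c) (hGR₃ V c) (hG_GOG V c hc) 0 = μ c 1 - μ c 0)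
  (hΔ₂ : ∀ {L : CMField} {ι₁ : L →+* ℂ} (V : HermSpace3 L ι₁) (c : SeesawCtx L), ∀ hc : GOG V c,
    slotTypeVec V c (hGR V c) (hGR₀ V c) (hGR₁ V c) (hGR₂ V c) (hGR₃ V c) (hG_GOG V c hc) 2 -
      slotTypeVec V c (hGR V c) (hGR₀ V c) (hGR₁ V c) (hGR₂ V c) (hGR₃ V c) (hG_GOG V c hc) 0 = μ c 2 - μ c 0)
  (hΔ₃ : ∀ {L : CMField} {ι₁ : L →+* ℂ} (V : HermSpace3 L ι₁) (c : SeesawCtx L), ∀ hc : GOG V c,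
    slotTypeVec V c (hGR V c) (hGR₀ V c) (hGR₁ V c) (hGR₂ V c) (hGR₃ V c) (hG_GOG V c hc) 3 -
      slotTypeVec V c (hGR V c) (hGR₀ V c) (hGR₁ V c) (hGR₂ V c) (hGR₃ V c) (hG_GOG V c hc) 0 = μ c 3 - μ c 0)

variable (F : CMField) [IsGalois ℚ F] (f : Face F) {ι₁ : F →+* ℂ} (V : HermSpace3 F ι₁) (D : StubTree.SeesawDatum F)

/-! ## §6 UN-INFLATED at a face: `Θ ⊆ U_{(F, f.psi i, ι₁)}(Γ)` — the literal `Uiso` shape of `FaceSupply` ∕ `RealisationExistsFace` consumers -/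

/-- **THE JUNCTION HEAD AT A FACE, UN-INFLATED.**  As `exists_faceCtx_hsmall_of_thm418C`, followed by CM-inflation monotonicity of the `U_Φ`-spans
(`Universe.Uiso_inflate_le` `PerL34/ThetaSubOfLiu.lean`:291: `U_{(M, Φ^M, σ')}(Γ) ≤ U_{(K, Φ, σ' ∘ k)}(Γ)`, from the model rows `Fact_pull_comp`
(`Model.modelAxiomsPerL`), `Fact_alphaLine` (`Model.fact_alphaLine`), `Fact_cmInflation` (`Model.fact_cmInflation_riemann`, from `hR`)): for an END STATE at a
face, `∃ D`, both guards hold and for every slot `i` there is `Γ₀` with `Θ(V, c, i, Γ) ⊆ U_{(F, f.psi i, ι₁)}(Γ)` for all `Γ ≤ Γ₀` — membership in the SAME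
`U.Uiso Γ F (f.psi i) ι₁` that `FaceSupply` (tree `CorCM/B01/FaceInputsSplit.lean`:50) displays; what this file does NOT give is the non-vanishing of a theta class
(the theta side's C4-type input). No proof holes. [folklore] -/
theorem exists_faceCtx_theta_subset_Uiso {hP : PrintFact_unitaryCompact} (C : (picardCMUniverse hHD hI h₁ h₃).AdelicThetaCore hP)
    (d12 d34 : ∀ {L : CMField}, SeesawCtx L → Universe.SideData L)
    (h6 : 6 ≤ Module.finrank ℚ F) (hadm : f.Admissible ι₁) (hcan : (mk ι₁).embedding = ι₁) (hR : DeligneMilne1982_Thm_6_20_full)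
    (hRΘ : ∀ (c : SeesawCtx F) (i : Fin 4) (Γ : Level V), (C.thetaModel (orientBitι F ι₁) d12 d34).Theta V c i Γ ⊆
      thetaOf _ (thetaClassInputOf _ (fun V c => thetaSpaceInputOf hHD hI h₁ h₃
        (SROGT'C @hGR @hGR₀ @hGR₁ @hGR₂ @hGR₃ @μ hΔ₁ hΔ₂ hΔ₃) V c)) V c i Γ)
    (h418 : ∀ a₀ : LiuIndex.RealScalar F,
      (liuDictionaryPin hHD hI h₁ h₃ hA V (LiuIndex.I V (LiuIndex.repAt a₀) (muLiu ι₁ LiuIndex.GramClass.rep))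
          (LiuIndex.line V (LiuIndex.repAt a₀) (muLiu ι₁ LiuIndex.GramClass.rep))).Thm418C) :
    ∃ D : StubTree.SeesawDatum F,
      ((C.thetaModel (orientBitι F ι₁) d12 d34).GoodCtx ι₁ (faceCtx F f ι₁ D) ∧ GOG V (faceCtx F f ι₁ D)) ∧
      ∀ i : Fin 4, ∃ Γ₀ : Level V, ∀ Γ ≤ Γ₀,
        (C.thetaModel (orientBitι F ι₁) d12 d34).Theta V (faceCtx F f ι₁ D) i Γ ⊆
          (picardCMUniverse hHD hI h₁ h₃).Uiso Γ F (f.psi i) ι₁ := by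
  obtain ⟨D, hg, h⟩ := exists_faceCtx_hsmall_of_thm418C hHD hI h₁ h₃ hA @hGR @hGR₀ @hGR₁ @hGR₂ @hGR₃ @μ hΔ₁ hΔ₂ hΔ₃ F f V
    C d12 d34 h6 hadm hcan hR hRΘ h418
  refine ⟨D, hg, fun i => ?_⟩
  obtain ⟨Γ₀, hΓ₀⟩ := h i
  refine ⟨Γ₀, fun Γ hΓ => ?_⟩
  obtain ⟨M, k, σ', hσ, hsub⟩ := hΓ₀ Γ hΓ
  have hle : (picardCMUniverse hHD hI h₁ h₃).Uiso Γ M (CMTypeOps.inflate k (f.psi i)) σ' ≤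
      (picardCMUniverse hHD hI h₁ h₃).Uiso Γ F (f.psi i) (σ'.comp k) :=
    Universe.Uiso_inflate_le (Model.modelAxiomsPerL hHD hI h₃ h₁).pull_comp (Model.fact_alphaLine hHD hI h₃ h₁)
      (Model.fact_cmInflation_riemann hHD hI h₃ h₁ hR) Γ F M k (f.psi i) σ'
  rw [hσ] at hle
  exact fun ω hω => hle (hsub hω)

end HodgeCM.Model.SInstance

end
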